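import Literature.NumberTheory.Automorphic.Qian2022PotentialAutomorphy
import Literature.NumberTheory.Automorphic.HarrisLanTaylorThorneThm713Proofs
import Literature.NumberTheory.Automorphic.AutomorphicRepsGLSatakeFlathProofs
import Literature.NumberTheory.Automorphic.ChebotarevArtinRepHolds
import Literature.NumberTheory.GaloisRepresentations.FramedRepEquivConj
import Literature.NumberTheory.GaloisRepresentations.LAdicRepFrobenius
import HarnessLib

/-!
# Qian's Def. 1.3 versus HLTT's characterising property: an automorphic `r` is conjugate to `r_ι(π)`

Topic `NumberTheory/Automorphic` (vocabulary of `Qian2022PotentialAutomorphy`: `Qian2022.IsAutomorphic`,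
`Qian2022.IsCompatible`; of `ReciprocityGLnProofs`: `HarrisLanTaylorThorne2016.IsCompatible`,
`theoremA_existence`).  PROOF FILE: one theorem, no definition, no named fact.

Qian 2023 (Invent. Math. 231), Def. 1.3 defines "`r` is automorphic" as `r ≅ r_{l,ι}(π)` for a regular
algebraic cuspidal `π`, where `r_{l,ι}(π)` is THE continuous semisimple representation characterised
(p. 1, after the HLTT preprint) by unramified compatibility at the places over the rational primes
`p ≠ l` above which BOTH `π` and the field are unramified; the tree renders it as
`Qian2022.IsAutomorphic ι r` = "`r` semisimple and Qian-compatible with some such `π`".  Consumers of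
facts stated for HLTT-compatible representations (`AHTW2026.deRham_hodgeTateRegular`,
`Varma2024.corollary93_unramified`, …: compatibility above every `q ≠ l` with `π` unramified above `q`,
no condition on the field) need the passage back:

* `Qian2022.IsAutomorphic.exists_hltt_conj` — granted the existence half of HLTT's Thm. A
  (`theoremA_existence`, a named fact taken as a hypothesis), a Qian-automorphic
  `r : Γ_K → GL_n(ℚ̄_l)` over a totally real or CM field `K` is `P · r' · P⁻¹` for a continuous
  semisimple `r'` with HLTT's property for the same `π` (and the same infinity type).  Proof: `r` and
  the representation `r'` of Thm. A agree (unramified, same characteristic polynomial of Frobenius) at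
  every place over a rational prime `q ≠ l` unramified in `K` above which `π` is unramified — a
  COFINITE set of places, by Flath's theorem (`AutomorphicRepData.hasSatakeParamAt_cofinite_holds`,
  PROVED) and the finiteness of the ramified rational primes
  (`HarrisLanTaylorThorne2016.finite_setOf_not_exists_goodPrime`, PROVED); so Chebotarev's density
  theorem (`chebotarev_artinRep_holds`, PROVED) and Brauer–Nesbitt
  (`FramedGaloisRep.nonempty_equiv_of_hasFrobCharpolyAt_eventually`) make them equivalent, hence conjugate
  (`FramedRep.exists_eq_conj_of_equiv`).  This is the uniqueness sentence of Qian's p. 1 ("there is a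
  unique continuous semisimple representation `r_{l,ι}(π)` such that …") combined with HLTT Thm. A.

## References

* [Qian2022] L. Qian, *Potential automorphy for `GL_n`*, Invent. Math. 231 (2023), 1239–1275, §1 p. 1
  (definition and uniqueness of `r_{l,ι}(π)`), Def. 1.3.
* [HarrisLanTaylorThorneRMS2016] M. Harris, K.-W. Lan, R. Taylor, J. Thorne, *On the rigid cohomology
  of certain Shimura varieties*, Res. Math. Sci. 3:37 (2016), Thm. A (p. 3).
* [DeligneSerreASENS1974] P. Deligne, J.-P. Serre, *Formes modulaires de poids 1*, Ann. Sci. ÉNS 7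
  (1974), Lemme 3.2 (Chebotarev + Brauer–Nesbitt).
-/

noncomputable section

open scoped NumberField
open NumberField IsDedekindDomain Field Filter
open Literature.NumberTheory.GaloisRepresentations

namespace Literature.NumberTheory.Automorphic

namespace Qian2022

variable {K : Type} [Field K] [NumberField K] {ℓ : ℕ} [Fact ℓ.Prime] {n : ℕ}

/-- **From Qian's Def. 1.3 to HLTT's characterising property, up to a change of frame.**  Let `K` be
totally real or CM and `r : Γ_K → GL_n(ℚ̄_ℓ)` automorphic in Qian's sense (`IsAutomorphic ι r`:
semisimple and Qian-compatible with a regular algebraic cuspidal `π`).  Granted the existence half of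
Harris–Lan–Taylor–Thorne's Thm. A, there are such a `π`, a regular algebraic infinity type `T` of `π`,
a continuous semisimple `r'` with HLTT's property for `π` (`HarrisLanTaylorThorne2016.IsCompatible`)
and `P ∈ GL_n(ℚ̄_ℓ)` with `r = P · r' · P⁻¹`: `r` and `r'` are unramified with the same characteristic
polynomial of Frobenius at every place over a rational prime `q ≠ ℓ` unramified in `K` above which `π`
is unramified, a cofinite set of places (Flath; finitely many ramified rational primes), so they are
equivalent by Chebotarev's density theorem and Brauer–Nesbitt, hence conjugate.
[cite: Qian2022, §1 p. 1 (uniqueness of r_{l,ι}(π)) and Def. 1.3] [cite: HarrisLanTaylorThorneRMS2016, Thm. A]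
[cite: DeligneSerreASENS1974, Lemme 3.2] -/
theorem IsAutomorphic.exists_hltt_conj (hA : HarrisLanTaylorThorne2016.theoremA_existence)
    (hK : IsTotallyReal K ∨ IsCMField K) {ι : PadicAlgCl ℓ ≃+* ℂ} {r : FramedGaloisRep K (PadicAlgCl ℓ) n}
    (hr : IsAutomorphic ι r) :
    ∃ (hcpt : isCompact_glFiniteIntegralLevel n K) (π : CuspidalAutomorphicRepData n K hcpt)
      (T : InfinityType K n) (r' : FramedGaloisRep K (PadicAlgCl ℓ) n) (P : GL (Fin n) (PadicAlgCl ℓ)),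
      π.1.HasInfinityType T ∧ T.IsRegularAlgebraic ∧ r'.toGaloisRep.IsSemisimple ∧
        HarrisLanTaylorThorne2016.IsCompatible π.1 ι r' ∧ r = FramedRep.conj P r' := by
  obtain ⟨hss, hcpt, π, ⟨T, hT, hTreg⟩, hQ⟩ := hr
  obtain ⟨r', hss', hc'⟩ := hA hcpt hK π ⟨T, hT, hTreg⟩ ℓ ι
  -- the two representations agree at the Qian-good places, a cofinite set
  have hev : ∀ᶠ v : HeightOneSpectrum (𝓞 K) in Filter.cofinite,
      r'.IsUnramifiedAt v ∧ r.IsUnramifiedAt v ∧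
        ∃ Q : Polynomial (PadicAlgCl ℓ), r'.HasFrobCharpolyAt v Q ∧ r.HasFrobCharpolyAt v Q := by
    have hfin := HarrisLanTaylorThorne2016.finite_setOf_not_exists_goodPrime π.1
      (AutomorphicRepData.hasSatakeParamAt_cofinite_holds π.1) ℓ Fact.out
    refine (Filter.eventually_cofinite.2 hfin).mono ?_
    intro v hv
    obtain ⟨q, hq, hqℓ, hKq, hπq, hqv⟩ := hv
    obtain ⟨α, hα⟩ := hπq v hqv
    have h1 := isCompatible_of_hltt hc' q hq hqℓ hKq hπq v hqv α hα
    have h2 := hQ q hq hqℓ hKq hπq v hqv α hα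
    exact ⟨h1.1, h2.1, _, h1.2, h2.2⟩
  obtain ⟨e⟩ := FramedGaloisRep.nonempty_equiv_of_hasFrobCharpolyAt_eventually
    chebotarev_artinRep_holds r' r hss' hss hev
  obtain ⟨P, hP⟩ := FramedRep.exists_eq_conj_of_equiv r' r e
  exact ⟨hcpt, π, T, r', P, hT, hTreg, hss', hc', hP⟩

end Qian2022

end Literature.NumberTheory.Automorphic
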